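/-
Copyright (c) 2026 The HCML crux team. All rights reserved.
Released under Apache 2.0 license as described in the file LICENSE.
Authors: K2E3-p14 (g5) (explicit-unit `hodgecm-mathlib-K2E3-p14-g5`)
-/
import Summits.HodgeConjecture.HodgeConjecture.Theorems.K2E3GLnUnipotentAdHeight        -- ★ (V0) p858112 (this seat): `ne_zero_of_coe_eq_diagonal`; brings ★ B4-0 file 1 (`adBall_iff_of_coe_eq_diagonal`)
import Literature.NumberTheory.Automorphic.GLnUnipotentRadicalUnimodular                -- ★ `mem_standardLeviGL_id_iff` (the diagonal torus `A = M_id`)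
import Literature.NumberTheory.Automorphic.ValuedFieldValuativeRelBridge                -- ★ `mem_glInt_iff_forall_v_le_one`
import Mathlib.Data.Int.Interval
import HarnessLib

/-!
# (GL-[M6]-sc, VOL brick V3) The torus window count: `α {a ∈ A : h(det a) ∈ W, 𝔅_ρ(a)} ≤ |W| · (2ρ+1)² · α(A(𝒪))`

Cell `hodgecm-mathlib`, Track B, line `K2_E3_EllipticInputs`; payer «GL-[M6]-sc» of leaf (11-3-split-sc-NE) (dealer K2E3-plan (g3) D63, line lead K2E3-p23
(g5), RULINGS #11 (M11-1) ∕ #12 (M12-4), BLUEPRINT v4 §2 «VOL-split»: «`a = n⁻¹k⁻¹z` ranges in `A ∩ F_D ∩ 𝔅`, Haar_A-volume `≤ 3(2·radius+1)² vol(A(𝒪))`»).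
In the `k · n · a` count of Harish-Chandra's Theorem 16 route [HarishChandra1970, Part VII §3 pp. 71–73] the torus variable `a = diag(a₀,a₁,a₂)` of the diagonal
torus `A = M_id ≤ GL₃(F)` is constrained by a DETERMINANT WINDOW (the fundamental domain of `ϖ^ℤ`, K2E3-p03 (g4)'s ★ integer height `h(g) = log v(det g)`) and by a
scale-invariant HEIGHT BALL `𝔅_ρ(a) ⇔ |log v(a_i) − log v(a_j)| ≤ ρ` (★ B4-0 `adBall_iff_of_coe_eq_diagonal`).  The valuation vector `e(a) = (log v(a_i))_i ∈ ℤ³` is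
then pinned by `(h, e₁ − e₀, e₂ − e₀) ∈ W × [−ρ, ρ]²`, and each fibre `{a : e(a) = e}` is a left translate of (a subset of) the compact open `A(𝒪) = A ∩ GL₃(𝒪)`,
so for every left-invariant measure `α` on `A`:
  **`α {a : h(det a) ∈ W ∧ 𝔅_ρ(a)} ≤ |W| · (2ρ+1)² · α(A(𝒪))`** (`measure_window_adBall_le`) — POLYNOMIAL in the radius `ρ`, which is where the conjugator height and
  the radius of Theorem 20 enter the majorant (v4 §0.1).
* §1 algebra of `A = M_id`: `coe_eq_diagonal` (elements are diagonal), `v_apply_ne_zero`, `log_v_det_eq_sum` (`h(det a) = Σ e_i(a)`), `sub_le_of_adBall` (`𝔅_ρ ⇒ e_i − e_j ≤ ρ`),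
  `inv_mul_mem_glInt_of_log_eq` (equal valuation vectors ⇒ `a₀⁻¹ a ∈ GL₃(𝒪)`).
* §2 `measure_cell_le` (each `(h, δ₁, δ₂)`-cell has measure `≤ α(A(𝒪))`) and the payload **`measure_window_adBall_le`**; `isCompact_setOf_coe_mem_glInt`,
  `measure_setOf_coe_mem_glInt_lt_top` (the constant is finite).

HONEST LABEL: HC_CM is proved only modulo the 7 printed citations (2 remaining named inputs: hLiu418 = stmt-HodgeConjecture-24832, h413 =
stmt-HodgeConjecture-24833) until rung 0 closes; count-neutral (kernel lane `--supports stmt-HodgeConjecture-24833 --as helper`), THEOREMS ONLY — no `def`, no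
instance, no notation, no `sorry`.

## References
* [HarishChandra1970] Harish-Chandra (notes by G. van Dijk), *Harmonic Analysis on Reductive p-adic Groups*, LNM 162 (1970), Part VII §3 pp. 71–73.
* [Cartier1979] P. Cartier, *Representations of 𝔭-adic groups: a survey*, PSPM 33.1 (1979), §IV.1 (`A(𝒪)`, the lattice `A ∕ A(𝒪) ≅ ℤ³`).
-/

set_option linter.dupNamespace false

noncomputable section

open MeasureTheory Measure Set Function Topology
open scoped MatrixGroups NNReal ENNReal WithZero
open Matrix ValuativeRel
open Literature.NumberTheory.Automorphic Literature.NumberTheory.GaloisRepresentations Literature.NumberTheory.GaloisRepresentations.IsNonarchimedeanLocalField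
open Summit.HodgeConjecture.HodgeConjecture.Cruxes.H413.K2E3GLnAdHeightBalls Summit.HodgeConjecture.HodgeConjecture.Cruxes.H413.K2E3GLnUnipotentAdHeight

namespace Summit.HodgeConjecture.HodgeConjecture.Cruxes.H413.K2E3GL3TorusWindowCount

/-! ## §1 Algebra of the diagonal torus `A = M_id ≤ GL₃(F)` -/

section Algebra

variable {F : Type*} [Field F]

/-- An element of the diagonal torus `A = M_id` IS a diagonal matrix. [cite: Cartier1979, §IV.1] -/
theorem coe_eq_diagonal (a : ↥(standardLeviGL F (id : Fin 3 → Fin 3))) :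
    ((a : GL (Fin 3) F) : Matrix (Fin 3) (Fin 3) F) = Matrix.diagonal fun i => ((a : GL (Fin 3) F) : Matrix (Fin 3) (Fin 3) F) i i := by
  have h := (mem_standardLeviGL_id_iff (a : GL (Fin 3) F)).1 a.2
  ext i j
  by_cases hij : i = j
  · subst hij; rw [Matrix.diagonal_apply_eq]
  · rw [Matrix.diagonal_apply_ne _ hij, h i j hij]

variable [Valued F ℤᵐ⁰]

/-- The diagonal entries of `a ∈ A` have non-zero valuation. [folklore] -/
theorem v_apply_ne_zero (a : ↥(standardLeviGL F (id : Fin 3 → Fin 3))) (i : Fin 3) :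
    Valued.v (((a : GL (Fin 3) F) : Matrix (Fin 3) (Fin 3) F) i i) ≠ 0 :=
  (Valuation.ne_zero_iff _).2 (ne_zero_of_coe_eq_diagonal (coe_eq_diagonal a) i)

/-- **`h(det a) = e₀(a) + e₁(a) + e₂(a)`**: the integer height of `det a` is the sum of the valuation exponents of the diagonal entries. [cite: Cartier1979, §IV.1] -/
theorem log_v_det_eq_sum (a : ↥(standardLeviGL F (id : Fin 3 → Fin 3))) :
    WithZero.log (Valued.v ((a : GL (Fin 3) F) : Matrix (Fin 3) (Fin 3) F).det) =
      WithZero.log (Valued.v (((a : GL (Fin 3) F) : Matrix (Fin 3) (Fin 3) F) 0 0)) +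
        WithZero.log (Valued.v (((a : GL (Fin 3) F) : Matrix (Fin 3) (Fin 3) F) 1 1)) +
          WithZero.log (Valued.v (((a : GL (Fin 3) F) : Matrix (Fin 3) (Fin 3) F) 2 2)) := by
  have h0 := v_apply_ne_zero a 0
  have h1 := v_apply_ne_zero a 1
  have h2 := v_apply_ne_zero a 2
  conv_lhs => rw [coe_eq_diagonal a, Matrix.det_diagonal, Fin.prod_univ_three]
  rw [map_mul, map_mul, WithZero.log_mul (mul_ne_zero h0 h1) h2, WithZero.log_mul h0 h1]

/-- **`𝔅_ρ(a) ⇒ e_i(a) − e_j(a) ≤ ρ`** for `a ∈ A` (the torus reading ★ `adBall_iff_of_coe_eq_diagonal` of the scale-invariant height ball, in integer exponents).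
[cite: HarishChandra1970, Part VII §3 p. 72] -/
theorem sub_le_of_adBall {ϖ : F} (hϖ : Valued.v ϖ = WithZero.exp (-1 : ℤ)) {ρ : ℕ} {a : ↥(standardLeviGL F (id : Fin 3 → Fin 3))}
    (h : ∀ i j k l, Valued.v (ϖ ^ ρ * (((a : GL (Fin 3) F) : Matrix (Fin 3) (Fin 3) F) i j * (((a : GL (Fin 3) F)⁻¹ : GL (Fin 3) F) : Matrix (Fin 3) (Fin 3) F) k l)) ≤ 1)
    (i j : Fin 3) :
    WithZero.log (Valued.v (((a : GL (Fin 3) F) : Matrix (Fin 3) (Fin 3) F) i i)) - WithZero.log (Valued.v (((a : GL (Fin 3) F) : Matrix (Fin 3) (Fin 3) F) j j)) ≤ ρ := by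
  have hij := (adBall_iff_of_coe_eq_diagonal ϖ ρ (coe_eq_diagonal a)).1 h i j
  have hi := v_apply_ne_zero a i
  have hj := v_apply_ne_zero a j
  have hvϖ : Valued.v (ϖ ^ ρ) = WithZero.exp (-(ρ : ℤ)) := by rw [map_pow, hϖ, ← WithZero.exp_nsmul, nsmul_eq_mul, mul_neg, mul_one]
  rw [map_mul, map_mul, map_inv₀, hvϖ, ← WithZero.exp_log hi, ← WithZero.exp_log hj, ← WithZero.exp_neg, ← WithZero.exp_add, ← WithZero.exp_add,
    ← WithZero.exp_zero, WithZero.exp_le_exp] at hij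
  omega

omit [Valued F ℤᵐ⁰] in
/-- Entries of `a₀⁻¹ a` for `a₀, a ∈ A`: `(a₀⁻¹ a)_{ii} = (a₀)_{ii}⁻¹ a_{ii}`, off-diagonal `0`. [folklore] -/
theorem coe_inv_mul_eq_diagonal (a₀ a : ↥(standardLeviGL F (id : Fin 3 → Fin 3))) :
    (((a₀ : GL (Fin 3) F)⁻¹ * (a : GL (Fin 3) F) : GL (Fin 3) F) : Matrix (Fin 3) (Fin 3) F) =
      Matrix.diagonal fun i => (((a₀ : GL (Fin 3) F) : Matrix (Fin 3) (Fin 3) F) i i)⁻¹ * ((a : GL (Fin 3) F) : Matrix (Fin 3) (Fin 3) F) i i := by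
  conv_lhs => rw [Units.val_mul, coe_inv_eq_diagonal_inv (coe_eq_diagonal a₀), coe_eq_diagonal a, Matrix.diagonal_mul_diagonal]

/-- **Equal valuation vectors ⇒ same `A(𝒪)`-coset**: if `e_i(a) = e_i(a₀)` for all `i` then `a₀⁻¹ a ∈ GL₃(𝒪)` (diagonal with unit entries). [cite: Cartier1979, §IV.1] -/
theorem inv_mul_mem_glInt_of_log_eq [ValuativeRel F] [(Valued.v : Valuation F ℤᵐ⁰).Compatible] {a₀ a : ↥(standardLeviGL F (id : Fin 3 → Fin 3))}
    (he : ∀ i, WithZero.log (Valued.v (((a : GL (Fin 3) F) : Matrix (Fin 3) (Fin 3) F) i i)) =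
      WithZero.log (Valued.v (((a₀ : GL (Fin 3) F) : Matrix (Fin 3) (Fin 3) F) i i))) :
    (a₀ : GL (Fin 3) F)⁻¹ * (a : GL (Fin 3) F) ∈ glInt 3 F := by
  -- the unit diagonal entries `u_i = (a₀)_{ii}⁻¹ a_{ii}` and their inverses have valuation `1`
  have hv : ∀ i, Valued.v ((((a₀ : GL (Fin 3) F) : Matrix (Fin 3) (Fin 3) F) i i)⁻¹ * ((a : GL (Fin 3) F) : Matrix (Fin 3) (Fin 3) F) i i) = 1 := by
    intro i
    have hi := v_apply_ne_zero a i
    have hi₀ := v_apply_ne_zero a₀ i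
    rw [map_mul, map_inv₀, ← WithZero.exp_log hi, ← WithZero.exp_log hi₀, he i, ← WithZero.exp_neg, ← WithZero.exp_add, neg_add_cancel, WithZero.exp_zero]
  have hd := coe_inv_mul_eq_diagonal a₀ a
  rw [mem_glInt_iff_forall_v_le_one]
  refine ⟨fun i j => ?_, fun i j => ?_⟩
  · rw [hd]
    by_cases hij : i = j
    · subst hij; rw [Matrix.diagonal_apply_eq, hv i]
    · rw [Matrix.diagonal_apply_ne _ hij, map_zero]; exact zero_le
  · rw [coe_inv_eq_diagonal_inv hd]
    by_cases hij : i = j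
    · subst hij; rw [Matrix.diagonal_apply_eq, map_inv₀, hv i, inv_one]
    · rw [Matrix.diagonal_apply_ne _ hij, map_zero]; exact zero_le

end Algebra

/-! ## §2 The window count -/

section Count

variable {F : Type*} [Field F] [Valued F ℤᵐ⁰] [ValuativeRel F] [(Valued.v : Valuation F ℤᵐ⁰).Compatible] [IsNonarchimedeanLocalField F]
  [MeasurableSpace (GL (Fin 3) F)] [BorelSpace (GL (Fin 3) F)]

/-- **ONE CELL HAS MEASURE AT MOST `α(A(𝒪))`**: for fixed `(s, δ₁, δ₂)`, the set of `a ∈ A` with `e₀+e₁+e₂ = s`, `e₁ − e₀ = δ₁`, `e₂ − e₀ = δ₂` (`e_i = log v(a_{ii})`) is empty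
or contained in ONE left `A(𝒪)`-coset, so every left-invariant measure gives it mass `≤ α(A(𝒪))`. [cite: Cartier1979, §IV.1] -/
theorem measure_cell_le (α : Measure ↥(standardLeviGL F (id : Fin 3 → Fin 3))) [α.IsMulLeftInvariant] (s δ₁ δ₂ : ℤ) :
    α {a | WithZero.log (Valued.v (((a : GL (Fin 3) F) : Matrix (Fin 3) (Fin 3) F) 0 0)) +
          WithZero.log (Valued.v (((a : GL (Fin 3) F) : Matrix (Fin 3) (Fin 3) F) 1 1)) +
          WithZero.log (Valued.v (((a : GL (Fin 3) F) : Matrix (Fin 3) (Fin 3) F) 2 2)) = s ∧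
        WithZero.log (Valued.v (((a : GL (Fin 3) F) : Matrix (Fin 3) (Fin 3) F) 1 1)) -
          WithZero.log (Valued.v (((a : GL (Fin 3) F) : Matrix (Fin 3) (Fin 3) F) 0 0)) = δ₁ ∧
        WithZero.log (Valued.v (((a : GL (Fin 3) F) : Matrix (Fin 3) (Fin 3) F) 2 2)) -
          WithZero.log (Valued.v (((a : GL (Fin 3) F) : Matrix (Fin 3) (Fin 3) F) 0 0)) = δ₂} ≤
      α {a | (a : GL (Fin 3) F) ∈ glInt 3 F} := by
  haveI : IsTopologicalRing F := inferInstance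
  haveI : BorelSpace ↥(standardLeviGL F (id : Fin 3 → Fin 3)) := Subtype.borelSpace _
  set C := {a : ↥(standardLeviGL F (id : Fin 3 → Fin 3)) |
      WithZero.log (Valued.v (((a : GL (Fin 3) F) : Matrix (Fin 3) (Fin 3) F) 0 0)) +
          WithZero.log (Valued.v (((a : GL (Fin 3) F) : Matrix (Fin 3) (Fin 3) F) 1 1)) +
          WithZero.log (Valued.v (((a : GL (Fin 3) F) : Matrix (Fin 3) (Fin 3) F) 2 2)) = s ∧
        WithZero.log (Valued.v (((a : GL (Fin 3) F) : Matrix (Fin 3) (Fin 3) F) 1 1)) -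
          WithZero.log (Valued.v (((a : GL (Fin 3) F) : Matrix (Fin 3) (Fin 3) F) 0 0)) = δ₁ ∧
        WithZero.log (Valued.v (((a : GL (Fin 3) F) : Matrix (Fin 3) (Fin 3) F) 2 2)) -
          WithZero.log (Valued.v (((a : GL (Fin 3) F) : Matrix (Fin 3) (Fin 3) F) 0 0)) = δ₂} with hC
  rcases Set.eq_empty_or_nonempty C with hC0 | ⟨a₀, ha₀⟩
  · rw [hC0, measure_empty]; exact zero_le
  · -- `C ⊆ a₀ · A(𝒪)`
    have hsub : C ⊆ (fun a => a₀⁻¹ * a) ⁻¹' {a : ↥(standardLeviGL F (id : Fin 3 → Fin 3)) | (a : GL (Fin 3) F) ∈ glInt 3 F} := by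
      intro a ha
      rw [Set.mem_preimage, Set.mem_setOf_eq, Subgroup.coe_mul, Subgroup.coe_inv]
      refine inv_mul_mem_glInt_of_log_eq fun i => ?_
      obtain ⟨hs, h1, h2⟩ := ha
      obtain ⟨hs₀, h1₀, h2₀⟩ := ha₀
      have h3 : ∀ i : Fin 3, i = 0 ∨ i = 1 ∨ i = 2 := by decide
      rcases h3 i with rfl | rfl | rfl <;> omega
    calc α C ≤ α ((fun a => a₀⁻¹ * a) ⁻¹' {a : ↥(standardLeviGL F (id : Fin 3 → Fin 3)) | (a : GL (Fin 3) F) ∈ glInt 3 F}) := measure_mono hsub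
      _ = α {a | (a : GL (Fin 3) F) ∈ glInt 3 F} := measure_preimage_mul α a₀⁻¹ _

/-- **THE TORUS WINDOW COUNT** (BLUEPRINT v4 §2, the `a`-range of `z = k·n·a`): for every left-invariant measure `α` on the diagonal torus `A ≤ GL₃(F)`, every finite
window `W ⊆ ℤ` of determinant heights and every radius `ρ`:
`α {a : log v(det a) ∈ W ∧ 𝔅_ρ(a)} ≤ |W| · (2ρ+1)² · α(A ∩ GL₃(𝒪))` — the valuation vector `(e_i(a))` is pinned by `(Σ e_i, e₁−e₀, e₂−e₀) ∈ W × [−ρ,ρ]²` (★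
`adBall_iff_of_coe_eq_diagonal`), and each such cell is inside one `A(𝒪)`-coset (`measure_cell_le`).  POLYNOMIAL in `ρ`. [cite: HarishChandra1970, Part VII §3 p. 72]
[cite: Cartier1979, §IV.1] -/
theorem measure_window_adBall_le (α : Measure ↥(standardLeviGL F (id : Fin 3 → Fin 3))) [α.IsMulLeftInvariant]
    {ϖ : F} (hϖ : Valued.v ϖ = WithZero.exp (-1 : ℤ)) (W : Finset ℤ) (ρ : ℕ) :
    α {a | WithZero.log (Valued.v ((a : GL (Fin 3) F) : Matrix (Fin 3) (Fin 3) F).det) ∈ W ∧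
        ∀ i j k l, Valued.v (ϖ ^ ρ * (((a : GL (Fin 3) F) : Matrix (Fin 3) (Fin 3) F) i j * (((a : GL (Fin 3) F)⁻¹ : GL (Fin 3) F) : Matrix (Fin 3) (Fin 3) F) k l)) ≤ 1} ≤
      ((W.card * (2 * ρ + 1) ^ 2 : ℕ) : ℝ≥0∞) * α {a | (a : GL (Fin 3) F) ∈ glInt 3 F} := by
  -- index the cells by `(s, δ₁, δ₂) ∈ W × [−ρ, ρ]²`
  set I : Finset (ℤ × ℤ × ℤ) := W ×ˢ (Finset.Icc (-(ρ : ℤ)) ρ ×ˢ Finset.Icc (-(ρ : ℤ)) ρ) with hI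
  let cell : ℤ × ℤ × ℤ → Set ↥(standardLeviGL F (id : Fin 3 → Fin 3)) := fun p =>
    {a | WithZero.log (Valued.v (((a : GL (Fin 3) F) : Matrix (Fin 3) (Fin 3) F) 0 0)) +
          WithZero.log (Valued.v (((a : GL (Fin 3) F) : Matrix (Fin 3) (Fin 3) F) 1 1)) +
          WithZero.log (Valued.v (((a : GL (Fin 3) F) : Matrix (Fin 3) (Fin 3) F) 2 2)) = p.1 ∧
        WithZero.log (Valued.v (((a : GL (Fin 3) F) : Matrix (Fin 3) (Fin 3) F) 1 1)) -
          WithZero.log (Valued.v (((a : GL (Fin 3) F) : Matrix (Fin 3) (Fin 3) F) 0 0)) = p.2.1 ∧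
        WithZero.log (Valued.v (((a : GL (Fin 3) F) : Matrix (Fin 3) (Fin 3) F) 2 2)) -
          WithZero.log (Valued.v (((a : GL (Fin 3) F) : Matrix (Fin 3) (Fin 3) F) 0 0)) = p.2.2}
  -- the window set is covered by the cells
  have hcover : {a : ↥(standardLeviGL F (id : Fin 3 → Fin 3)) | WithZero.log (Valued.v ((a : GL (Fin 3) F) : Matrix (Fin 3) (Fin 3) F).det) ∈ W ∧
        ∀ i j k l, Valued.v (ϖ ^ ρ * (((a : GL (Fin 3) F) : Matrix (Fin 3) (Fin 3) F) i j *
          (((a : GL (Fin 3) F)⁻¹ : GL (Fin 3) F) : Matrix (Fin 3) (Fin 3) F) k l)) ≤ 1} ⊆ ⋃ p ∈ I, cell p := by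
    rintro a ⟨hW, hB⟩
    have h10 := sub_le_of_adBall hϖ hB 1 0
    have h01 := sub_le_of_adBall hϖ hB 0 1
    have h20 := sub_le_of_adBall hϖ hB 2 0
    have h02 := sub_le_of_adBall hϖ hB 0 2
    rw [log_v_det_eq_sum] at hW
    refine Set.mem_iUnion₂.2 ⟨(_, _, _), ?_, rfl, rfl, rfl⟩
    simp only [hI, Finset.mem_product, Finset.mem_Icc]
    exact ⟨hW, ⟨by omega, by omega⟩, by omega, by omega⟩
  -- count
  have hcard : I.card = W.card * (2 * ρ + 1) ^ 2 := by
    have hIcc : (Finset.Icc (-(ρ : ℤ)) ρ).card = 2 * ρ + 1 := by rw [Int.card_Icc]; omega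
    rw [hI, Finset.card_product, Finset.card_product, hIcc, sq]
  calc α _ ≤ α (⋃ p ∈ I, cell p) := measure_mono hcover
    _ ≤ ∑ p ∈ I, α (cell p) := measure_biUnion_finset_le I cell
    _ ≤ ∑ _p ∈ I, α {a | (a : GL (Fin 3) F) ∈ glInt 3 F} := Finset.sum_le_sum fun p _ => measure_cell_le α p.1 p.2.1 p.2.2
    _ = ((W.card * (2 * ρ + 1) ^ 2 : ℕ) : ℝ≥0∞) * α {a | (a : GL (Fin 3) F) ∈ glInt 3 F} := by
      rw [Finset.sum_const, hcard, nsmul_eq_mul]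

omit [(Valued.v : Valuation F ℤᵐ⁰).Compatible] [MeasurableSpace (GL (Fin 3) F)] [BorelSpace (GL (Fin 3) F)] in
/-- `A(𝒪) = {a ∈ A : a ∈ GL₃(𝒪)}` is COMPACT in `A` (closed torus ★ ∩ compact `GL₃(𝒪)` ★). [cite: Cartier1979, §IV.1] -/
theorem isCompact_setOf_coe_mem_glInt : IsCompact {a : ↥(standardLeviGL F (id : Fin 3 → Fin 3)) | (a : GL (Fin 3) F) ∈ glInt 3 F} := by
  haveI : IsTopologicalRing F := inferInstance
  haveI : T2Space F := (isLocalField F).toT2Space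
  rw [Subtype.isCompact_iff]
  have heq : ((↑) : ↥(standardLeviGL F (id : Fin 3 → Fin 3)) → GL (Fin 3) F) '' {a | (a : GL (Fin 3) F) ∈ glInt 3 F} =
      (glInt 3 F : Set (GL (Fin 3) F)) ∩ (standardLeviGL F (id : Fin 3 → Fin 3) : Set (GL (Fin 3) F)) := by
    ext g
    constructor
    · rintro ⟨a, ha, rfl⟩; exact ⟨ha, a.2⟩
    · rintro ⟨hg, hgA⟩; exact ⟨⟨g, hgA⟩, hg, rfl⟩
  rw [heq]
  exact (isCompact_glInt 3 F).inter_right (isClosed_standardLeviGL (R := F) (id : Fin 3 → Fin 3))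

omit [(Valued.v : Valuation F ℤᵐ⁰).Compatible] [BorelSpace (GL (Fin 3) F)] in
/-- `α(A(𝒪)) < ∞` for every measure on `A` finite on compacta (e.g. a Haar measure) — the constant of `measure_window_adBall_le` is finite. [cite: Cartier1979, §IV.1] -/
theorem measure_setOf_coe_mem_glInt_lt_top (α : Measure ↥(standardLeviGL F (id : Fin 3 → Fin 3))) [IsFiniteMeasureOnCompacts α] :
    α {a | (a : GL (Fin 3) F) ∈ glInt 3 F} < ⊤ :=
  isCompact_setOf_coe_mem_glInt.measure_lt_top

end Count

end Summit.HodgeConjecture.HodgeConjecture.Cruxes.H413.K2E3GL3TorusWindowCount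

end
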